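import Mathlib
import HarnessLib

/-!
# Planar bounds for the Riesz kernel `1/|z − x|` on discs (towards the log-Poincaré inequality for small sets)

Analysis/FunctionSpaces support file (everything proved), on the Euclidean plane `ℝ² = EuclideanSpace ℝ (Fin 2)` with Lebesgue
measure.  Radial integration on discs and three kernel estimates used to turn the mean-value potential estimate
(Gilbarg–Trudinger Lemma 7.16, `MeanValuePotentialEstimate`) into the planar log-Poincaré inequality for small sets
(`|⨍_A f − ⨍_{B_R} f|² ≤ C (1 + log(πR²/|A|)) ∫_{B_R} |∇f|²`, Gilbarg–Trudinger §7.8):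

* `setIntegral_ball_fun_norm_sub` — polar integration on a disc: `∫_{B(x,L)} g(|z − x|) dz = 2π ∫₀ᴸ y g(y) dy`;
* `integral_inv_max_le` — `∫₀ᴸ dy / max(y, ρ) ≤ 1 + log(L/ρ)` (`0 < ρ ≤ L`);
* `lintegral_ball_inv_norm_mul_max_le` — `∫_{B(x,L)} dz/(|z−x| max(|z−x|, ρ)) ≤ 2π(1 + log(L/ρ))`;
* `lintegral_ball_inv_norm_mul_inv_norm_le` — THE TWO-POLE BOUND `∫_{B(c,R)} dz/(|z−x||z−x′|) ≤ 4π(1 + log(4R/|x−x′|))`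
  for `x ≠ x′` in `B(c,R)`;
* `lintegral_ball_log_le` — `∫_{B(x′,r)} log(4R/|z−x′|) dz ≤ πr²(log(4R/r) + 2)` (`0 < r ≤ 4R`).

[cite: GilbargTrudinger2001, Lemma 7.12 (proof: estimates of the Riesz kernel on balls)]
-/

noncomputable section

open MeasureTheory Set Filter Metric Function Module Real
open scoped ENNReal NNReal Topology

namespace Literature.Analysis.FunctionSpaces

section Radial

/-- Translating a disc to the origin inside an indicator. [cite: GilbargTrudinger2001, Lemma 7.12 (proof)] -/
theorem indicator_ball_norm_sub (g : ℝ → ℝ) (x : (EuclideanSpace ℝ (Fin 2))) (L : ℝ) (z : (EuclideanSpace ℝ (Fin 2))) :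
    (ball x L).indicator (fun z : (EuclideanSpace ℝ (Fin 2)) => g ‖z - x‖) z = (ball (0 : (EuclideanSpace ℝ (Fin 2))) L).indicator (fun w : (EuclideanSpace ℝ (Fin 2)) => g ‖w‖) (z - x) := by
  by_cases hz : z ∈ ball x L
  · have hz' : z - x ∈ ball (0 : (EuclideanSpace ℝ (Fin 2))) L := by rwa [mem_ball_zero_iff, ← dist_eq_norm, ← mem_ball]
    rw [indicator_of_mem hz, indicator_of_mem hz']
  · have hz' : z - x ∉ ball (0 : (EuclideanSpace ℝ (Fin 2))) L := by rwa [mem_ball_zero_iff, ← dist_eq_norm, ← mem_ball]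
    rw [indicator_of_notMem hz, indicator_of_notMem hz']

/-- The indicator of a disc at the origin is a radial function. [cite: GilbargTrudinger2001, Lemma 7.12 (proof)] -/
theorem indicator_ball_zero_eq (g : ℝ → ℝ) (L : ℝ) (w : (EuclideanSpace ℝ (Fin 2))) :
    (ball (0 : (EuclideanSpace ℝ (Fin 2))) L).indicator (fun w : (EuclideanSpace ℝ (Fin 2)) => g ‖w‖) w = (Iio L).indicator g ‖w‖ := by
  by_cases hw : w ∈ ball (0 : (EuclideanSpace ℝ (Fin 2))) L
  · have hw' : ‖w‖ ∈ Iio L := by rwa [mem_Iio, ← mem_ball_zero_iff]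
    rw [indicator_of_mem hw, indicator_of_mem hw']
  · have hw' : ‖w‖ ∉ Iio L := by rwa [mem_Iio, ← mem_ball_zero_iff]
    rw [indicator_of_notMem hw, indicator_of_notMem hw']

/-- The area of the unit disc. [cite: GilbargTrudinger2001, Lemma 7.12 (proof)] -/
theorem volume_real_unitBall_fin_two : (volume : Measure (EuclideanSpace ℝ (Fin 2))).real (ball (0 : (EuclideanSpace ℝ (Fin 2))) 1) = π := by
  rw [measureReal_def, EuclideanSpace.volume_ball_fin_two, ENNReal.ofReal_one, one_pow, one_mul,
    ENNReal.toReal_ofReal pi_pos.le]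

/-- **Polar integration on a disc**: `∫_{B(x,L)} g(‖z − x‖) dz = 2π ∫_{(0,L)} y·g(y) dy` (any `g`; both sides are `0` when
`y ↦ y g(y)` is not integrable on `(0,L)`). [cite: GilbargTrudinger2001, Lemma 7.12 (proof)] -/
theorem setIntegral_ball_fun_norm_sub (g : ℝ → ℝ) (x : (EuclideanSpace ℝ (Fin 2))) (L : ℝ) :
    ∫ z in ball x L, g ‖z - x‖ = 2 * π * ∫ y in Ioo 0 L, y * g y := by
  -- translate to the origin and pass to the indicator
  have h1 : ∫ z in ball x L, g ‖z - x‖ = ∫ w, (Iio L).indicator g ‖w‖ ∂(volume : Measure (EuclideanSpace ℝ (Fin 2))) := by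
    rw [← integral_indicator measurableSet_ball]
    have e : (fun z : (EuclideanSpace ℝ (Fin 2)) => (ball x L).indicator (fun z : (EuclideanSpace ℝ (Fin 2)) => g ‖z - x‖) z) =
        fun z => (fun w : (EuclideanSpace ℝ (Fin 2)) => (Iio L).indicator g ‖w‖) (z - x) := by
      funext z
      rw [indicator_ball_norm_sub, indicator_ball_zero_eq]
    rw [e, integral_sub_right_eq_self (fun w : (EuclideanSpace ℝ (Fin 2)) => (Iio L).indicator g ‖w‖) x]
  rw [h1, integral_fun_norm_addHaar, volume_real_unitBall_fin_two, finrank_euclideanSpace, Fintype.card_fin]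
  have e2 : (fun y : ℝ => y ^ (2 - 1) • (Iio L).indicator g y) = (Iio L).indicator fun y => y * g y := by
    funext y
    rw [show (2 : ℕ) - 1 = 1 from rfl, pow_one, smul_eq_mul]
    by_cases hy : y ∈ Iio L
    · rw [indicator_of_mem hy, indicator_of_mem hy]
    · rw [indicator_of_notMem hy, indicator_of_notMem hy, mul_zero]
  rw [e2, setIntegral_indicator measurableSet_Iio, Ioi_inter_Iio, nsmul_eq_mul, smul_eq_mul]
  push_cast
  ring

/-- Integrability on a disc of a radial function from the one-dimensional integrability of `y ↦ y g(y)` on `(0,L)`.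
[cite: GilbargTrudinger2001, Lemma 7.12 (proof)] -/
theorem integrableOn_ball_fun_norm_sub {g : ℝ → ℝ} {L : ℝ} (hg : IntegrableOn (fun y => y * g y) (Ioo 0 L)) (x : (EuclideanSpace ℝ (Fin 2))) :
    IntegrableOn (fun z : (EuclideanSpace ℝ (Fin 2)) => g ‖z - x‖) (ball x L) := by
  have h0 : IntegrableOn (fun w : (EuclideanSpace ℝ (Fin 2)) => g ‖w‖) (ball (0 : (EuclideanSpace ℝ (Fin 2))) L) := by
    rw [integrableOn_fun_norm_addHaar]
    simpa [finrank_euclideanSpace] using hg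
  have h1 : Integrable ((ball (0 : (EuclideanSpace ℝ (Fin 2))) L).indicator fun w : (EuclideanSpace ℝ (Fin 2)) => g ‖w‖) (volume : Measure (EuclideanSpace ℝ (Fin 2))) :=
    h0.integrable_indicator measurableSet_ball
  have h2 := h1.comp_sub_right x
  rw [← integrable_indicator_iff measurableSet_ball]
  refine h2.congr (Eventually.of_forall fun z => ?_)
  exact (indicator_ball_norm_sub g x L z).symm

end Radial

section OneDim

/-- `∫_{(0,L)} dy / max(y, ρ) ≤ 1 + log(L/ρ)` for `0 < ρ ≤ L`. [cite: GilbargTrudinger2001, Lemma 7.12 (proof)] -/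
theorem integral_inv_max_le {ρ L : ℝ} (hρ : 0 < ρ) (hρL : ρ ≤ L) :
    ∫ y in Ioo 0 L, (max y ρ)⁻¹ ≤ 1 + Real.log (L / ρ) := by
  have hL : 0 < L := hρ.trans_le hρL
  have hcont : Continuous fun y : ℝ => (max y ρ)⁻¹ :=
    (continuous_id.max continuous_const).inv₀ fun y => (lt_max_of_lt_right hρ).ne'
  have hii : ∀ a b : ℝ, IntervalIntegrable (fun y : ℝ => (max y ρ)⁻¹) volume a b := fun a b => hcont.intervalIntegrable _ _
  rw [← integral_Ioc_eq_integral_Ioo, ← intervalIntegral.integral_of_le hL.le,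
    ← intervalIntegral.integral_add_adjacent_intervals (hii 0 ρ) (hii ρ L)]
  refine add_le_add ?_ ?_
  · -- on `[0, ρ]` the integrand is `≤ 1/ρ`
    calc ∫ y in (0 : ℝ)..ρ, (max y ρ)⁻¹ ≤ ∫ _ in (0 : ℝ)..ρ, ρ⁻¹ := by
          refine intervalIntegral.integral_mono_on hρ.le (hii 0 ρ) (by simp) fun y hy => ?_
          exact inv_anti₀ hρ (le_max_right _ _)
      _ = 1 := by rw [intervalIntegral.integral_const, sub_zero, smul_eq_mul, mul_inv_cancel₀ hρ.ne']
  · -- on `[ρ, L]` the integrand is `1/y`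
    have e : ∫ y in ρ..L, (max y ρ)⁻¹ = ∫ y in ρ..L, y⁻¹ := by
      refine intervalIntegral.integral_congr fun y hy => ?_
      rw [uIcc_of_le hρL] at hy
      simp only [max_eq_left hy.1]
    rw [e, integral_inv_of_pos hρ hL]

/-- `y log(4R/y) ≤ y log(4R/r) + r` for `0 < y`, `0 < r` (from `log t ≤ t − 1`). [cite: GilbargTrudinger2001, Lemma 7.12 (proof)] -/
theorem mul_log_div_le {y r R : ℝ} (hy : 0 < y) (hr : 0 < r) (hR : 0 < R) :
    y * Real.log (4 * R / y) ≤ y * Real.log (4 * R / r) + r := by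
  have h1 : Real.log (4 * R / y) = Real.log (4 * R / r) + Real.log (r / y) := by
    rw [← Real.log_mul (by positivity) (by positivity)]
    congr 1
    field_simp
  have h2 : y * Real.log (r / y) ≤ r := by
    have h := Real.log_le_sub_one_of_pos (show 0 < r / y by positivity)
    calc y * Real.log (r / y) ≤ y * (r / y - 1) := mul_le_mul_of_nonneg_left h hy.le
      _ = r - y := by field_simp
      _ ≤ r := by linarith
  rw [h1, mul_add]
  linarith

/-- `∫_{(0,r)} y log(4R/y) dy ≤ r² (log(4R/r)/2 + 1)` for `0 < r ≤ 4R`. [cite: GilbargTrudinger2001, Lemma 7.12 (proof)] -/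
theorem integral_mul_log_div_le {r R : ℝ} (hr : 0 < r) (hR : 0 < R) (hrR : r ≤ 4 * R) :
    ∫ y in Ioo 0 r, y * Real.log (4 * R / y) ≤ r ^ 2 * (Real.log (4 * R / r) / 2 + 1) := by
  have hlog : 0 ≤ Real.log (4 * R / r) := Real.log_nonneg ((one_le_div hr).2 hrR)
  have hbound : ∀ y ∈ Ioo 0 r, y * Real.log (4 * R / y) ≤ y * Real.log (4 * R / r) + r := fun y hy =>
    mul_log_div_le hy.1 hr hR
  have hint2 : IntegrableOn (fun y : ℝ => y * Real.log (4 * R / r) + r) (Ioo 0 r) :=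
    ((continuous_id.mul continuous_const).add continuous_const).integrableOn_Icc.mono_set Ioo_subset_Icc_self
  -- integrability of `y log(4R/y)` on `(0,r)`: bounded by the affine majorant and nonnegative
  have hm : AEStronglyMeasurable (fun y : ℝ => y * Real.log (4 * R / y)) (volume.restrict (Ioo 0 r)) :=
    (measurable_id.mul ((measurable_const.div measurable_id).log)).aestronglyMeasurable
  have hnn : ∀ y ∈ Ioo 0 r, 0 ≤ y * Real.log (4 * R / y) := fun y hy =>
    mul_nonneg hy.1.le (Real.log_nonneg ((one_le_div hy.1).2 (by linarith [hy.2])))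
  have hint1 : IntegrableOn (fun y : ℝ => y * Real.log (4 * R / y)) (Ioo 0 r) := by
    refine Integrable.mono' hint2 hm ?_
    filter_upwards [ae_restrict_mem measurableSet_Ioo] with y hy
    rw [Real.norm_of_nonneg (hnn y hy)]
    exact hbound y hy
  calc ∫ y in Ioo 0 r, y * Real.log (4 * R / y) ≤ ∫ y in Ioo 0 r, (y * Real.log (4 * R / r) + r) :=
        setIntegral_mono_on hint1 hint2 measurableSet_Ioo hbound
    _ = r ^ 2 * (Real.log (4 * R / r) / 2 + 1) := by
        have hI1 : IntervalIntegrable (fun x : ℝ => x * Real.log (4 * R / r)) volume 0 r :=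
          (continuous_id.mul continuous_const).intervalIntegrable _ _
        have hI2 : IntervalIntegrable (fun _ : ℝ => r) volume 0 r := continuous_const.intervalIntegrable _ _
        rw [← integral_Ioc_eq_integral_Ioo, ← intervalIntegral.integral_of_le hr.le, intervalIntegral.integral_add hI1 hI2,
          intervalIntegral.integral_mul_const, integral_id, intervalIntegral.integral_const]
        simp only [smul_eq_mul]
        ring

end OneDim

section Kernels

/-- **`∫_{B(x,L)} dz/(‖z−x‖ max(‖z−x‖, ρ)) ≤ 2π(1 + log(L/ρ))`** for `0 < ρ ≤ L`. [cite: GilbargTrudinger2001, Lemma 7.12 (proof)] -/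
theorem lintegral_ball_inv_norm_mul_max_le {ρ L : ℝ} (hρ : 0 < ρ) (hρL : ρ ≤ L) (x : (EuclideanSpace ℝ (Fin 2))) :
    ∫⁻ z in ball x L, ENNReal.ofReal ((‖z - x‖ * max ‖z - x‖ ρ)⁻¹) ≤ ENNReal.ofReal (2 * π * (1 + Real.log (L / ρ))) := by
  -- the radial profile `g y = (y max(y,ρ))⁻¹` has `y g(y) = (max y ρ)⁻¹` on `(0,L)`
  have hyg : ∀ y ∈ Ioo 0 L, y * (y * max y ρ)⁻¹ = (max y ρ)⁻¹ := fun y hy => by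
    rw [mul_inv, ← mul_assoc, mul_inv_cancel₀ hy.1.ne', one_mul]
  have hcont : Continuous fun y : ℝ => (max y ρ)⁻¹ :=
    (continuous_id.max continuous_const).inv₀ fun y => (lt_max_of_lt_right hρ).ne'
  have hint : IntegrableOn (fun y : ℝ => y * (y * max y ρ)⁻¹) (Ioo 0 L) :=
    (hcont.integrableOn_Icc.mono_set Ioo_subset_Icc_self).congr_fun (fun y hy => (hyg y hy).symm) measurableSet_Ioo
  have hint2 : IntegrableOn (fun z : (EuclideanSpace ℝ (Fin 2)) => (‖z - x‖ * max ‖z - x‖ ρ)⁻¹) (ball x L) :=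
    integrableOn_ball_fun_norm_sub (g := fun y => (y * max y ρ)⁻¹) hint x
  have hnn : 0 ≤ᵐ[volume.restrict (ball x L)] fun z : (EuclideanSpace ℝ (Fin 2)) => (‖z - x‖ * max ‖z - x‖ ρ)⁻¹ :=
    Eventually.of_forall fun z => inv_nonneg.2 (mul_nonneg (norm_nonneg _) ((hρ.le).trans (le_max_right _ _)))
  rw [← ofReal_integral_eq_lintegral_ofReal hint2 hnn]
  refine ENNReal.ofReal_le_ofReal ?_
  rw [setIntegral_ball_fun_norm_sub (fun y => (y * max y ρ)⁻¹) x L, setIntegral_congr_fun measurableSet_Ioo hyg]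
  exact mul_le_mul_of_nonneg_left (integral_inv_max_le hρ hρL) (by positivity)

/-- **THE TWO-POLE BOUND**: for `x ≠ x′` in `B(c, R)`, `∫_{B(c,R)} dz/(‖z−x‖‖z−x′‖) ≤ 4π(1 + log(4R/‖x−x′‖))`.
[cite: GilbargTrudinger2001, Lemma 7.12 (proof)] -/
theorem lintegral_ball_inv_norm_mul_inv_norm_le {c x x' : (EuclideanSpace ℝ (Fin 2))} {R : ℝ} (hx : x ∈ ball c R) (hx' : x' ∈ ball c R) (hne : x ≠ x') :
    ∫⁻ z in ball c R, ENNReal.ofReal ((‖z - x‖ * ‖z - x'‖)⁻¹) ≤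
      ENNReal.ofReal (4 * π * (1 + Real.log (4 * R / ‖x - x'‖))) := by
  have hR : 0 < R := lt_of_le_of_lt dist_nonneg (mem_ball.1 hx)
  set ρ : ℝ := ‖x - x'‖ / 2 with hρdef
  have hxx : 0 < ‖x - x'‖ := norm_pos_iff.2 (sub_ne_zero.2 hne)
  have hρ : 0 < ρ := by positivity
  have hxx2 : ‖x - x'‖ < 2 * R := by
    calc ‖x - x'‖ = dist x x' := (dist_eq_norm _ _).symm
      _ ≤ dist x c + dist x' c := dist_triangle_right _ _ _
      _ < R + R := add_lt_add (mem_ball.1 hx) (mem_ball.1 hx')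
      _ = 2 * R := by ring
  have hρL : ρ ≤ 2 * R := by rw [hρdef]; linarith
  have hlog : 2 * R / ρ = 4 * R / ‖x - x'‖ := by rw [hρdef]; field_simp; ring
  -- pointwise splitting of the kernel
  have hpt : ∀ z : (EuclideanSpace ℝ (Fin 2)), ENNReal.ofReal ((‖z - x‖ * ‖z - x'‖)⁻¹) ≤
      ENNReal.ofReal ((‖z - x‖ * max ‖z - x‖ ρ)⁻¹) + ENNReal.ofReal ((‖z - x'‖ * max ‖z - x'‖ ρ)⁻¹) := by
    intro z
    have htri : ‖x - x'‖ ≤ ‖z - x‖ + ‖z - x'‖ := by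
      calc ‖x - x'‖ = ‖(z - x') - (z - x)‖ := by rw [sub_sub_sub_cancel_left]
        _ ≤ ‖z - x'‖ + ‖z - x‖ := norm_sub_le _ _
        _ = ‖z - x‖ + ‖z - x'‖ := add_comm _ _
    have hA : 0 ≤ (‖z - x‖ * max ‖z - x‖ ρ)⁻¹ := inv_nonneg.2 (mul_nonneg (norm_nonneg _) (hρ.le.trans (le_max_right _ _)))
    have hB : 0 ≤ (‖z - x'‖ * max ‖z - x'‖ ρ)⁻¹ := inv_nonneg.2 (mul_nonneg (norm_nonneg _) (hρ.le.trans (le_max_right _ _)))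
    rw [← ENNReal.ofReal_add hA hB]
    refine ENNReal.ofReal_le_ofReal ?_
    rcases le_total ‖z - x‖ ‖z - x'‖ with h | h
    · -- `‖z − x′‖ ≥ max(‖z − x‖, ρ)`
      have hm : max ‖z - x‖ ρ ≤ ‖z - x'‖ := max_le h (by rw [hρdef]; linarith)
      rcases eq_or_lt_of_le (norm_nonneg (z - x)) with h0 | h0
      · rw [← h0, zero_mul, inv_zero, zero_mul, inv_zero, zero_add]; exact hB
      · calc (‖z - x‖ * ‖z - x'‖)⁻¹ ≤ (‖z - x‖ * max ‖z - x‖ ρ)⁻¹ :=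
            inv_anti₀ (mul_pos h0 (lt_max_of_lt_right hρ)) (mul_le_mul_of_nonneg_left hm h0.le)
          _ ≤ _ := le_add_of_nonneg_right hB
    · have hm : max ‖z - x'‖ ρ ≤ ‖z - x‖ := max_le h (by rw [hρdef]; linarith)
      rcases eq_or_lt_of_le (norm_nonneg (z - x')) with h0 | h0
      · rw [← h0, mul_zero, inv_zero, zero_mul, inv_zero, add_zero]; exact hA
      · calc (‖z - x‖ * ‖z - x'‖)⁻¹ = (‖z - x'‖ * ‖z - x‖)⁻¹ := by rw [mul_comm]
          _ ≤ (‖z - x'‖ * max ‖z - x'‖ ρ)⁻¹ :=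
            inv_anti₀ (mul_pos h0 (lt_max_of_lt_right hρ)) (mul_le_mul_of_nonneg_left hm h0.le)
          _ ≤ _ := le_add_of_nonneg_left hA
  have hsub : ∀ y ∈ ball c R, ball c R ⊆ ball y (2 * R) := fun y hy z hz => by
    rw [mem_ball] at hy hz ⊢
    calc dist z y ≤ dist z c + dist y c := dist_triangle_right _ _ _
      _ < R + R := add_lt_add hz hy
      _ = 2 * R := by ring
  calc ∫⁻ z in ball c R, ENNReal.ofReal ((‖z - x‖ * ‖z - x'‖)⁻¹)
      ≤ ∫⁻ z in ball c R, (ENNReal.ofReal ((‖z - x‖ * max ‖z - x‖ ρ)⁻¹) + ENNReal.ofReal ((‖z - x'‖ * max ‖z - x'‖ ρ)⁻¹)) :=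
        lintegral_mono fun z => hpt z
    _ = (∫⁻ z in ball c R, ENNReal.ofReal ((‖z - x‖ * max ‖z - x‖ ρ)⁻¹)) +
          ∫⁻ z in ball c R, ENNReal.ofReal ((‖z - x'‖ * max ‖z - x'‖ ρ)⁻¹) := by
        refine lintegral_add_left ?_ _
        exact ((continuous_norm.comp (continuous_id.sub continuous_const)).mul
          ((continuous_norm.comp (continuous_id.sub continuous_const)).max continuous_const)).measurable.inv.ennreal_ofReal
    _ ≤ (∫⁻ z in ball x (2 * R), ENNReal.ofReal ((‖z - x‖ * max ‖z - x‖ ρ)⁻¹)) +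
          ∫⁻ z in ball x' (2 * R), ENNReal.ofReal ((‖z - x'‖ * max ‖z - x'‖ ρ)⁻¹) :=
        add_le_add (lintegral_mono_set (hsub x hx)) (lintegral_mono_set (hsub x' hx'))
    _ ≤ ENNReal.ofReal (2 * π * (1 + Real.log (2 * R / ρ))) + ENNReal.ofReal (2 * π * (1 + Real.log (2 * R / ρ))) :=
        add_le_add (lintegral_ball_inv_norm_mul_max_le hρ hρL x) (lintegral_ball_inv_norm_mul_max_le hρ hρL x')
    _ = ENNReal.ofReal (4 * π * (1 + Real.log (4 * R / ‖x - x'‖))) := by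
        have h0 : 0 ≤ 2 * π * (1 + Real.log (2 * R / ρ)) := by
          have : 0 ≤ Real.log (2 * R / ρ) := Real.log_nonneg ((one_le_div hρ).2 hρL)
          positivity
        rw [← ENNReal.ofReal_add h0 h0, hlog]
        ring_nf

/-- **`∫_{B(x′,r)} log(4R/‖z − x′‖) dz ≤ π r² (log(4R/r) + 2)`** for `0 < r ≤ 4R`. [cite: GilbargTrudinger2001, Lemma 7.12 (proof)] -/
theorem lintegral_ball_log_le {r R : ℝ} (hr : 0 < r) (hR : 0 < R) (hrR : r ≤ 4 * R) (x' : (EuclideanSpace ℝ (Fin 2))) :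
    ∫⁻ z in ball x' r, ENNReal.ofReal (Real.log (4 * R / ‖z - x'‖)) ≤ ENNReal.ofReal (π * r ^ 2 * (Real.log (4 * R / r) + 2)) := by
  have hbound : ∀ y ∈ Ioo 0 r, y * Real.log (4 * R / y) ≤ y * Real.log (4 * R / r) + r := fun y hy =>
    mul_log_div_le hy.1 hr hR
  have hnn1 : ∀ y ∈ Ioo 0 r, 0 ≤ y * Real.log (4 * R / y) := fun y hy =>
    mul_nonneg hy.1.le (Real.log_nonneg ((one_le_div hy.1).2 (by linarith [hy.2])))
  have hint : IntegrableOn (fun y : ℝ => y * Real.log (4 * R / y)) (Ioo 0 r) := by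
    have hint2 : IntegrableOn (fun y : ℝ => y * Real.log (4 * R / r) + r) (Ioo 0 r) :=
      ((continuous_id.mul continuous_const).add continuous_const).integrableOn_Icc.mono_set Ioo_subset_Icc_self
    have hm : AEStronglyMeasurable (fun y : ℝ => y * Real.log (4 * R / y)) (volume.restrict (Ioo 0 r)) :=
      (measurable_id.mul ((measurable_const.div measurable_id).log)).aestronglyMeasurable
    refine Integrable.mono' hint2 hm ?_
    filter_upwards [ae_restrict_mem measurableSet_Ioo] with y hy
    rw [Real.norm_of_nonneg (hnn1 y hy)]
    exact hbound y hy
  have hint2 : IntegrableOn (fun z : (EuclideanSpace ℝ (Fin 2)) => Real.log (4 * R / ‖z - x'‖)) (ball x' r) :=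
    integrableOn_ball_fun_norm_sub (g := fun y => Real.log (4 * R / y)) hint x'
  have hnn : 0 ≤ᵐ[volume.restrict (ball x' r)] fun z : (EuclideanSpace ℝ (Fin 2)) => Real.log (4 * R / ‖z - x'‖) := by
    filter_upwards [ae_restrict_mem measurableSet_ball] with z hz
    simp only [Pi.zero_apply]
    rcases eq_or_lt_of_le (norm_nonneg (z - x')) with h0 | h0
    · rw [← h0, div_zero, Real.log_zero]
    · have hzr : ‖z - x'‖ < r := by rwa [mem_ball, dist_eq_norm] at hz
      exact Real.log_nonneg ((one_le_div h0).2 (by linarith))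
  rw [← ofReal_integral_eq_lintegral_ofReal hint2 hnn]
  refine ENNReal.ofReal_le_ofReal ?_
  rw [setIntegral_ball_fun_norm_sub (fun y => Real.log (4 * R / y)) x' r]
  calc 2 * π * ∫ y in Ioo 0 r, y * Real.log (4 * R / y) ≤ 2 * π * (r ^ 2 * (Real.log (4 * R / r) / 2 + 1)) :=
        mul_le_mul_of_nonneg_left (integral_mul_log_div_le hr hR hrR) (by positivity)
    _ = π * r ^ 2 * (Real.log (4 * R / r) + 2) := by ring

end Kernels

section Exchange

variable {α : Type*} [MeasurableSpace α] {ν : Measure α}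

/-- **EXCHANGE LEMMA (bathtub)**: if `h ≥ m` on `B`, `h ≤ m` off `B`, `ν A = ν B < ∞`, then `∫_A h ≤ ∫_B h`.
[cite: GilbargTrudinger2001, Lemma 7.12 (proof)] -/
theorem setLIntegral_le_of_level {A B : Set α} (hA : MeasurableSet A) (hB : MeasurableSet B) (hAB : ν A = ν B) (hAfin : ν A ≠ ⊤)
    {h : α → ℝ≥0∞} {m : ℝ≥0∞} (hge : ∀ z ∈ B, m ≤ h z) (hle : ∀ z, z ∉ B → h z ≤ m) :
    ∫⁻ z in A, h z ∂ν ≤ ∫⁻ z in B, h z ∂ν := by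
  -- `ν (A \ B) = ν (B \ A)`
  have hdiff : ν (A \ B) = ν (B \ A) := by
    have h1 : ν (A ∩ B) + ν (A \ B) = ν A := measure_inter_add_sdiff A hB
    have h2 : ν (B ∩ A) + ν (B \ A) = ν B := measure_inter_add_sdiff B hA
    rw [inter_comm B A, ← hAB, ← h1] at h2
    have hfin : ν (A ∩ B) ≠ ⊤ := ((measure_mono inter_subset_left).trans_lt hAfin.lt_top).ne
    exact ((ENNReal.add_right_inj hfin).1 h2).symm
  calc ∫⁻ z in A, h z ∂ν = (∫⁻ z in A ∩ B, h z ∂ν) + ∫⁻ z in A \ B, h z ∂ν := (lintegral_inter_add_sdiff h A hB).symm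
    _ ≤ (∫⁻ z in A ∩ B, h z ∂ν) + ∫⁻ z in B \ A, h z ∂ν := by
        gcongr 1
        calc ∫⁻ z in A \ B, h z ∂ν ≤ ∫⁻ _ in A \ B, m ∂ν := setLIntegral_mono' (hA.diff hB) fun z hz => hle z hz.2
          _ = m * ν (A \ B) := setLIntegral_const _ _
          _ = m * ν (B \ A) := by rw [hdiff]
          _ = ∫⁻ _ in B \ A, m ∂ν := (setLIntegral_const _ _).symm
          _ ≤ ∫⁻ z in B \ A, h z ∂ν := setLIntegral_mono' (hB.diff hA) fun z hz => hge z hz.1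
    _ = (∫⁻ z in B ∩ A, h z ∂ν) + ∫⁻ z in B \ A, h z ∂ν := by rw [inter_comm]
    _ = ∫⁻ z in B, h z ∂ν := lintegral_inter_add_sdiff h B hA

end Exchange

end Literature.Analysis.FunctionSpaces

end
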